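import Literature.NumberTheory.Automorphic.WhittakerTwistedJacquet
import Literature.NumberTheory.Automorphic.SiegelMultiplicity
import HarnessLib

/-!
# The unipotent radicals `U_c ≤ GL_n(F)` are limits of compact open subgroups; exactness of the
Jacquet functors `r_{U_c}` on `GL_n(F)`

Topic `NumberTheory/Automorphic`; namespace `Literature.NumberTheory.Automorphic`. Proof file
(theorems only: no definition, no named fact, no instance).

The exactness of the Jacquet functor `r_P ρ = ρ_N` proved in the tree
(`Representation.jacquet_exact_holds`, `Representation.jacquetMap_injective`, file
`JacquetModuleExactProofs`; Bernstein–Zelevinsky 1976, Prop. 2.35; 1977, Prop. 1.9 (a)) carries the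
hypothesis `IsLimitOfCompactOpen ↥t.N` (file `JacquetModule`): the "unipotent radical" of the
abstract parabolic triple must be the union of its compact open subgroups ("a limit of compact
subgroups", Bernstein–Zelevinsky 1977, §1.9). For the standard parabolic triples
`parabolicTripleGL F c = (P_c, M_c, U_c)` of `GL_n(F)` (file `ParabolicGL`), `F` a non-archimedean
local field, this hypothesis had not been discharged in the tree. This file discharges it:

* `IsLimitOfCompactOpen.of_le`: a CLOSED subgroup `N ≤ U` of a subgroup `U ≤ G` which is a limit of
  compact open subgroups is again one (intersect a compact open `K ≤ U` containing the image of a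
  compact `C ⊆ N` with `N`; compactness because `N` is closed);
* `mem_unipotentRadicalGL_iff_entry`, `isClosed_unipotentRadicalGL`: `U_c` is cut out by the closed
  entry conditions "block triangular for `c`" (Mathlib `isClosed_setOf_blockTriangular`) and
  `g_{ij} = δ_{ij}` inside the diagonal blocks, hence closed for Hausdorff `R`;
* `isLimitOfCompactOpen_unipotentRadicalGL`: for a monotone block labelling `c : Fin n → α`,
  `U_c ≤ U_n` (`unipotentRadicalGL_le_upperUnitriangular`, file `SiegelMultiplicity`) and `U_n(F)`
  is a limit of compact open subgroups (`isLimitOfCompactOpen_upperUnitriangular`, file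
  `WhittakerTwistedJacquet`: `U_n(F) = ⋃_m U_n(F) ∩ t_m⁻¹ GL_n(𝒪_F) t_m`), so `U_c(F)` is one
  (also as `isLimitOfCompactOpen_parabolicTripleGL_N` for the field `.N` of the triple);
* `jacquetMap_parabolicTripleGL_injective`: consequently (the tree's
  `Representation.jacquetMap_injective`) **the Jacquet functor `r_{P_c}` on smooth representations
  of `GL_n(F)` is left exact** — an injective intertwining map `ρ₁ → ρ₂` with `ρ₂` smooth induces
  an injection `r_{P_c} ρ₁ ↪ r_{P_c} ρ₂` (Bernstein–Zelevinsky 1977, Prop. 1.9 (a) with 2.3;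
  1976, Prop. 2.35), with no residual hypothesis.

## References

* I. N. Bernstein, A. V. Zelevinsky, *Induced representations of reductive `p`-adic groups I*,
  Ann. Sci. ÉNS (4) 10 (1977), 441–472, §1.9, Prop. 1.9 (a), §2.1–2.3 (held:
  `paper:galaxy-pdf-5846323419317184580`). [BernsteinZelevinskyASENS1977]
* I. N. Bernstein, A. V. Zelevinsky, *Representations of the group `GL(n, F)` where `F` is a
  non-archimedean local field*, Russian Math. Surveys 31:3 (1976), Prop. 2.35 (not held).
  [BernsteinZelevinskyRMS1976]
-/

open Matrix

namespace Literature.NumberTheory.Automorphic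

/-! ### Closed subgroups of limits of compact open subgroups -/

section Transfer

variable {G : Type*} [Group G] [TopologicalSpace G]

/-- **A closed subgroup of a limit of compact open subgroups is a limit of compact open
subgroups**: if `U ≤ G` is the union of its compact open subgroups (`IsLimitOfCompactOpen ↥U`,
Bernstein–Zelevinsky 1977, §1.9) and `N ≤ U` is closed in `G`, then so is `N` — a compact
`C ⊆ N` lies in a compact open `K ≤ U`, and `K ∩ N ≤ N` is open, compact (`N` closed) and
contains `C`. [cite: BernsteinZelevinskyASENS1977, §1.9] -/
theorem IsLimitOfCompactOpen.of_le {U N : Subgroup G} (hU : IsLimitOfCompactOpen ↥U) (hNU : N ≤ U)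
    (hN : IsClosed (N : Set G)) : IsLimitOfCompactOpen ↥N := by
  intro C hC
  have hι : Continuous (Subgroup.inclusion hNU) :=
    continuous_induced_rng.2 continuous_subtype_val
  obtain ⟨K, hKo, hKc, hCK⟩ := hU _ (hC.image hι)
  refine ⟨K.comap (Subgroup.inclusion hNU), hKo.preimage hι, ?_, fun x hx => hCK ⟨x, hx, rfl⟩⟩
  -- compactness: the image in `G` is `K ∩ N`, compact as `N` is closed
  rw [Subtype.isCompact_iff]
  have himage : ((↑) : ↥N → G) '' (K.comap (Subgroup.inclusion hNU) : Set ↥N) =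
      ((↑) : ↥U → G) '' (K : Set ↥U) ∩ (N : Set G) := by
    ext g
    constructor
    · rintro ⟨x, hx, rfl⟩
      exact ⟨⟨Subgroup.inclusion hNU x, hx, rfl⟩, x.2⟩
    · rintro ⟨⟨y, hy, rfl⟩, hyN⟩
      have hy' : Subgroup.inclusion hNU ⟨(y : G), hyN⟩ = y := Subtype.ext rfl
      refine ⟨⟨(y : G), hyN⟩, ?_, rfl⟩
      rw [SetLike.mem_coe, Subgroup.mem_comap, hy']
      exact hy
  rw [himage]
  exact (hKc.image continuous_subtype_val).inter_right hN

end Transfer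

/-! ### `U_c` is closed -/

section Closed

variable {R : Type*} [CommRing R] [TopologicalSpace R] [T2Space R]
  {n : Type*} [Fintype n] [DecidableEq n] {α : Type*} [LinearOrder α] (c : n → α)

omit [TopologicalSpace R] [T2Space R] in
/-- Membership in the unipotent radical `U_c`, entrywise: `g` is block triangular for `c` and
agrees with the identity inside the diagonal blocks (`mem_unipotentRadicalGL_iff` of `ParabolicGL`
with `toSquareBlock c a = 1` spelled out on entries). [folklore] -/
theorem mem_unipotentRadicalGL_iff_entry (g : GL n R) :
    g ∈ unipotentRadicalGL R c ↔ (g : Matrix n n R).BlockTriangular c ∧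
      ∀ i j, c i = c j → (g : Matrix n n R) i j = (1 : Matrix n n R) i j := by
  rw [mem_unipotentRadicalGL_iff]
  refine and_congr_right fun _ => ⟨fun h i j hij => ?_, fun h a => ?_⟩
  · have h2 := congrFun (congrFun (h (c i)) ⟨i, rfl⟩) ⟨j, hij.symm⟩
    rw [Matrix.toSquareBlock_def, Matrix.of_apply] at h2
    rw [h2, Matrix.one_apply, Matrix.one_apply]
    by_cases hij' : i = j
    · subst hij'; simp
    · rw [if_neg hij', if_neg (fun h' => hij' (Subtype.ext_iff.1 h'))]
  · ext ⟨i, hi⟩ ⟨j, hj⟩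
    rw [Matrix.toSquareBlock_def, Matrix.of_apply, h i j (hi.trans hj.symm), Matrix.one_apply,
      Matrix.one_apply]
    by_cases hij' : i = j
    · subst hij'; simp
    · rw [if_neg hij', if_neg (fun h' => hij' (Subtype.ext_iff.1 h'))]

/-- **`U_c` is closed in `GL_n(R)`** for Hausdorff `R`: it is cut out by the closed conditions
"block triangular for `c`" (Mathlib `isClosed_setOf_blockTriangular`) and `g_{ij} = δ_{ij}` for
`c i = c j` on the continuous matrix entries (cf. `isClosed_standardParabolicGL` of
`ParabolicInduction`, `isClosed_upperUnitriangular` of `ReductionTheoryGLnConjugation`). [folklore] -/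
theorem isClosed_unipotentRadicalGL :
    IsClosed (unipotentRadicalGL R c : Set (GL n R)) := by
  have h : (unipotentRadicalGL R c : Set (GL n R)) =
      (fun g : GL n R => (g : Matrix n n R)) ⁻¹' {M | M.BlockTriangular c} ∩
        ⋂ i : n, ⋂ j : n, ⋂ (_ : c i = c j),
          (fun g : GL n R => (g : Matrix n n R) i j) ⁻¹' {(1 : Matrix n n R) i j} := by
    ext g
    simp only [SetLike.mem_coe, mem_unipotentRadicalGL_iff_entry, Set.mem_inter_iff,
      Set.mem_preimage, Set.mem_setOf_eq, Set.mem_iInter, Set.mem_singleton_iff]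
  rw [h]
  exact ((isClosed_setOf_blockTriangular (b := c)).preimage Units.continuous_val).inter
    (isClosed_iInter fun i => isClosed_iInter fun j => isClosed_iInter fun _ =>
      isClosed_singleton.preimage (Units.continuous_val.matrix_elem i j))

end Closed

/-! ### `U_c(F)` is a limit of compact open subgroups; `r_{P_c}` is left exact on `GL_n(F)` -/

section LocalField

variable (F : Type*) [Field F] [ValuativeRel F] [TopologicalSpace F] [IsNonarchimedeanLocalField F]
  {n : ℕ} {α : Type*} [LinearOrder α] (c : Fin n → α)

/-- **The unipotent radical `U_c(F)` of a standard parabolic of `GL_n(F)` is a limit of compact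
open subgroups** (Bernstein–Zelevinsky 1977, §1.9, the hypothesis of Prop. 1.9 (a) for
`r_{U_c,θ}`), for a monotone block labelling `c`: `U_c ≤ U_n`
(`unipotentRadicalGL_le_upperUnitriangular`), `U_c` is closed (`isClosed_unipotentRadicalGL`,
`F` Hausdorff) and `U_n(F)` is a limit of compact open subgroups
(`isLimitOfCompactOpen_upperUnitriangular`). [cite: BernsteinZelevinskyASENS1977, §1.9] -/
theorem isLimitOfCompactOpen_unipotentRadicalGL (hc : Monotone c) :
    IsLimitOfCompactOpen ↥(unipotentRadicalGL F c) :=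
  haveI : T2Space F := (GaloisRepresentations.IsNonarchimedeanLocalField.isLocalField F).toT2Space
  (isLimitOfCompactOpen_upperUnitriangular F n).of_le (unipotentRadicalGL_le_upperUnitriangular c hc)
    (isClosed_unipotentRadicalGL c)

/-- The same for the field `.N = U_c` of the standard parabolic triple `parabolicTripleGL F c`
(`parabolicTripleGL_N`, `rfl`). [cite: BernsteinZelevinskyASENS1977, §1.9] -/
theorem isLimitOfCompactOpen_parabolicTripleGL_N [Fintype α] (hc : Monotone c) :
    IsLimitOfCompactOpen ↥(parabolicTripleGL F c).N :=
  isLimitOfCompactOpen_unipotentRadicalGL F c hc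

variable {F} in
/-- **Left exactness of the Jacquet functor `r_{P_c}` on `GL_n(F)`** (Bernstein–Zelevinsky 1977,
Prop. 1.9 (a) with §2.3; 1976, Prop. 2.35): for a monotone block labelling `c`, a smooth complex
(indeed characteristic-`0`) representation `ρ₂` of `GL_n(F)` and an injective intertwining map
`f : ρ₁ → ρ₂`, the induced map of Jacquet modules `r_{P_c} ρ₁ → r_{P_c} ρ₂` is injective — the
tree's `Representation.jacquetMap_injective` with its hypothesis `IsLimitOfCompactOpen ↥U_c`
discharged by `isLimitOfCompactOpen_parabolicTripleGL_N`. [cite: BernsteinZelevinskyASENS1977, Prop. 1.9 (a)] -/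
theorem jacquetMap_parabolicTripleGL_injective [Fintype α] (hc : Monotone c)
    {k : Type*} [Field k] [CharZero k] {V₁ V₂ : Type*} [AddCommGroup V₁] [Module k V₁]
    [AddCommGroup V₂] [Module k V₂] {ρ₁ : Representation k (GL (Fin n) F) V₁}
    {ρ₂ : Representation k (GL (Fin n) F) V₂} (h₂ : ρ₂.IsSmooth) (f : ρ₁.IntertwiningMap ρ₂)
    (hf : Function.Injective f) :
    Function.Injective (Representation.jacquetMap (parabolicTripleGL F c) f) :=
  Representation.jacquetMap_injective (parabolicTripleGL F c)
    (isLimitOfCompactOpen_parabolicTripleGL_N F c hc) h₂ f hf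

end LocalField

end Literature.NumberTheory.Automorphic
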